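import Summits.HodgeConjecture.HodgeConjecture.Theorems.Q8BireflectionGroupDensity
import Literature.AlgebraicGeometry.HodgeTheory.GlIdentityComponentInvariantSplitting
import Mathlib.RingTheory.Flat.Basic
import HarnessLib

/-!
# Route `Q8SymplecticPowers`, crux K1Q — BQ-CORE in the RATIONAL-AMBIENT currency of the skeleton «mechanism-v2» (stubs S4 (iii), S5):
# the variable quaternionic part `W ≤ H` of an ambient `K`-space, hypotheses on `W ⊗ ℂ ⊆ ℂ ⊗ H`, conclusion for the restrictions to `W`

Support file for crux K1Q (stmt-HodgeConjecture-24190; `--supports … --as helper`). Prover seat `hodge-nonav-prover-Ax` (g17), on the route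
owner's and the S7 author's request (hodge-nonav-p3 g36 11:54Z, 19716-p2 g13 12:12Z): S4 (iii) ∕ S5 are registered AMBIENTLY on
`ℂ ⊗_ℚ H²(X_s; ℚ)` with `Mv.baseChange ℂ`, `A.baseChange ℂ`, `γ.toLinearMap.baseChange ℂ` (`Γ = ratMonodromyGroup ≤ GL_ℚ(H²)`), while
BQ-CORE (`Q8BireflectionGroupDensity`) lives on an abstract `V` with `a² = b² = −1`. This file does the restriction-to-`W` and
`ℂ ⊗ ↥W ≃ W.baseChange ℂ` bookkeeping once:

* §1 transport along `φ = (W.subtype).baseChange L : L ⊗ W → L ⊗ H` (injective, image `W.baseChange L`): naturality for maps preserving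
  `W` (`subtype_baseChange_comm`), the restricted form (`baseChange_compl₁₂_subtype`), eigenvectors, and the identification
  `(eigenspace a_L i).map φ = W.baseChange L ⊓ eigenspace A_L i` (`map_eigenspace_restrict_eq`); plus the rfl lemma
  `glBaseChangeHom_apply_eq_baseChange` asked for by the route owner and `glIdentityComponent_subset_of_finiteIndex`
  (`Θ ≤ Γ` of finite index ⇒ `(Γ^Zar)° ⊆ (Θ^Zar)°`, the inclusion complementary to the tree's `glIdentityComponent_mono`).
* §2 **`mem_glIdentityComponent_restrict_of_bireflection`**: `H` a finite-dimensional `K`-space (`K → ℂ`), `Q` symmetric on `H`,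
  `A, B ∈ End H`, `W ≤ H` stable under `A, B` with `A² = B² = −1`, `AB = −BA` on `W`, `A, B` `Q`-isometries on `W`, `Q|_W` non-degenerate;
  `Γ ≤ GL_K(H)` preserving `W`, commuting with `A, B` and preserving `Q` on `W`; hypotheses (h_sirr), (h_bi), `6 ≤ dim` LITERALLY in the
  S4 (iii) ∕ S5 shape on `W.baseChange ℂ ⊓ eigenspace (A.baseChange ℂ) i`; conclusion: for `g ∈ GL_K(H)` preserving `W`, commuting with
  `A, B` and `Q`-isometric on `W`, its restriction `g_W` lies in `glIdentityComponent Γ_W`, where `Γ_W ≤ GL(W)` is the group of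
  restrictions (`η ∈ Γ_W ↔ ∃ θ ∈ Γ, η = θ|_W` — the interface of `GlIdentityComponentInvariantSplitting`). Proof:
  `mem_glIdentityComponent_of_bireflection_baseChange'` on `V := W` after §1. Conditional exactly on the four Katz named facts.
HONEST FRAMING: algebra only; K1Q ∕ HC ∕ HC_AV NOT proved; item 24190 OPEN (S4, S5 are its open geometric stubs).
-/

noncomputable section

set_option linter.dupNamespace false

namespace Summit.HodgeConjecture.HodgeConjecture.Theorems.Q8BireflectionGroupDensityAmbient

open Module Literature.AlgebraicGeometry.Motives Literature.AlgebraicGeometry.HodgeTheory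
open Literature.Algebra.Lie Literature.Algebra.Lie.KatzRecognition
open Summit.HodgeConjecture.HodgeConjecture.Theorems.Q8BireflectionGroupDensity
open LinearMap (BilinForm)
open scoped TensorProduct

/-! ### §1 Transport along `φ = (W.subtype).baseChange L` -/

section Transport

variable {K : Type*} [Field K] {L : Type*} [Field L] [Algebra K L] {H : Type*} [AddCommGroup H] [Module K H]
  (W : Submodule K H)

/-- `glBaseChangeHom K L V γ x = (γ.toLinearMap.baseChange L) x` (pointwise form of the tree's `coe_glBaseChangeHom`; asked for by the
route owner for the S4∕S5∕S7 currency). -/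
theorem glBaseChangeHom_apply_eq_baseChange (γ : H ≃ₗ[K] H) (x : L ⊗[K] H) :
    glBaseChangeHom K L H γ x = (γ : H →ₗ[K] H).baseChange L x := rfl

/-- `φ = (W.subtype).baseChange L` is injective (`L` is flat over the field `K`). -/
theorem subtype_baseChange_injective : Function.Injective (W.subtype.baseChange L) :=
  (LinearMap.injective_rangeRestrict_iff _).1 (Submodule.toBaseChange_injective L W)

/-- `W.baseChange L` is the range of `φ`. -/
theorem mem_baseChange_iff_exists {x : L ⊗[K] H} : x ∈ W.baseChange L ↔ ∃ y, W.subtype.baseChange L y = x := LinearMap.mem_range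

/-- Naturality of `φ`: if `η : W → W` and `f : H → H` agree (`η = f|_W`) then `φ ∘ η_L = f_L ∘ φ`. -/
theorem subtype_baseChange_comm {η : W →ₗ[K] W} {f : H →ₗ[K] H} (h : ∀ x : W, ((η x : W) : H) = f x) (y : L ⊗[K] W) :
    W.subtype.baseChange L (η.baseChange L y) = f.baseChange L (W.subtype.baseChange L y) := by
  have hc : W.subtype ∘ₗ η = f ∘ₗ W.subtype := LinearMap.ext fun x => h x
  rw [← LinearMap.comp_apply, ← LinearMap.baseChange_comp, hc, LinearMap.baseChange_comp, LinearMap.comp_apply]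

/-- The base change of the restricted form is the restriction of the base-changed form along `φ`. -/
theorem baseChange_compl₁₂_subtype (Q : BilinForm K H) (y y' : L ⊗[K] W) :
    LinearMap.BilinForm.baseChange L (Q.compl₁₂ W.subtype W.subtype : BilinForm K W) y y' =
      Q.baseChange L (W.subtype.baseChange L y) (W.subtype.baseChange L y') := by
  induction y using TensorProduct.induction_on with
  | zero => simp
  | tmul c w =>
    induction y' using TensorProduct.induction_on with
    | zero => simp
    | tmul c' w' =>
      simp [LinearMap.BilinForm.baseChange_tmul, LinearMap.baseChange_tmul, LinearMap.compl₁₂_apply]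
    | add u v hu hv => rw [map_add, map_add, map_add, hu, hv]
  | add u v hu hv => rw [map_add, LinearMap.add_apply, map_add, map_add, LinearMap.add_apply, hu, hv]

/-- Eigenvectors of a restriction correspond under `φ`. -/
theorem restrict_baseChange_eq_smul_iff {f : H →ₗ[K] H} (hf : ∀ x ∈ W, f x ∈ W) (c : L) (y : L ⊗[K] W) :
    (f.restrict hf).baseChange L y = c • y ↔ f.baseChange L (W.subtype.baseChange L y) = c • W.subtype.baseChange L y := by
  rw [← subtype_baseChange_comm W (η := f.restrict hf) (f := f) (fun x => rfl) y, ← map_smul]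
  exact ⟨fun h => by rw [h], fun h => subtype_baseChange_injective W h⟩

/-- `φ (eigenspace (f|_W)_L c) = W.baseChange L ⊓ eigenspace f_L c`. -/
theorem map_eigenspace_restrict_eq {f : H →ₗ[K] H} (hf : ∀ x ∈ W, f x ∈ W) (c : L) :
    (Module.End.eigenspace ((f.restrict hf).baseChange L) c).map (W.subtype.baseChange L) =
      W.baseChange L ⊓ Module.End.eigenspace (f.baseChange L) c := by
  apply le_antisymm
  · rintro _ ⟨y, hy, rfl⟩
    rw [SetLike.mem_coe, Module.End.mem_eigenspace_iff] at hy
    exact ⟨(mem_baseChange_iff_exists W).2 ⟨y, rfl⟩,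
      Module.End.mem_eigenspace_iff.2 ((restrict_baseChange_eq_smul_iff W hf c y).1 hy)⟩
  · rintro x ⟨hxW, hx⟩
    obtain ⟨y, rfl⟩ := (mem_baseChange_iff_exists W).1 hxW
    refine ⟨y, ?_, rfl⟩
    rw [SetLike.mem_coe, Module.End.mem_eigenspace_iff, restrict_baseChange_eq_smul_iff W hf c y]
    exact Module.End.mem_eigenspace_iff.1 hx

end Transport

/-- **`(Γ^Zar)° ⊆ (Θ^Zar)°` for `Θ ≤ Γ` of FINITE INDEX** (with the tree's `glIdentityComponent_mono`: equality): a finite-index subgroup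
of `Θ` has finite index in `Γ`. -/
theorem glIdentityComponent_subset_of_finiteIndex {K : Type*} [Field K] {M : Type*} [AddCommGroup M] [Module K M]
    [Module.Finite K M] {Θ Γ : Subgroup (M ≃ₗ[K] M)} (hle : Θ ≤ Γ) (hfi : (Θ.subgroupOf Γ).FiniteIndex) :
    glIdentityComponent Γ ⊆ glIdentityComponent Θ := by
  intro g hg
  rw [mem_glIdentityComponent_iff] at hg ⊢
  intro Θ' hΘ' hfi'
  refine hg Θ' (hΘ'.trans hle) ⟨?_⟩
  change Θ'.relIndex Γ ≠ 0
  have h1 : Θ'.relIndex Θ ≠ 0 := hfi'.index_ne_zero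
  have h2 : Θ.relIndex Γ ≠ 0 := hfi.index_ne_zero
  rw [← Subgroup.relIndex_mul_relIndex Θ' Θ Γ hΘ' hle]
  exact mul_ne_zero h1 h2

/-! ### §2 BQ-CORE in the rational-ambient currency -/

/-- **BQ-CORE for the variable quaternionic part `W ≤ H` (rational-ambient currency of stubs S4 (iii), S5 of «mechanism-v2»).**
`K → ℂ`; `H` finite-dimensional over `K` with a symmetric bilinear form `Q`; `A, B ∈ End_K H`; `W ≤ H` stable under `A, B`, on which
`A² = B² = −1`, `AB = −BA`, `A, B` are `Q`-isometries and `Q` is non-degenerate; `Γ ≤ GL_K(H)` preserving `W`, commuting with `A, B` on `W`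
and `Q`-isometric on `W`; `i ∈ ℂ`, `i² = −1`, `M := W.baseChange ℂ ⊓ eigenspace (A.baseChange ℂ) i` of dimension `≥ 6`;
(h_sirr) every finite-index `Γ' ≤ Γ` leaves invariant no subspace of `M` other than `⊥, M` (action through `γ.toLinearMap.baseChange ℂ`);
(h_bi) some `γ ∈ Γ` acts on `W.baseChange ℂ` as an `(i, −i)`-bireflection of `(M, Q_ℂ(·, B_ℂ ·))`. Let `Γ_W ≤ GL_K(W)` be the group of
restrictions of `Γ` (`η ∈ Γ_W ↔ ∃ θ ∈ Γ, η = θ|_W`). Then for every `g ∈ GL_K(H)` commuting with `A, B` on `W` and `Q`-isometric on `W`,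
every restriction `g_W ∈ GL_K(W)` of `g` lies in `glIdentityComponent Γ_W`. GIVEN Katz's Thm 1.4 (both forms), Thm 1.5, Rmk 1.4.1 as named
facts. (Combine with `GlIdentityComponentInvariantSplitting` to return to `GL_K(H)`.) K1Q ∕ HC are NOT proved here. -/
theorem mem_glIdentityComponent_restrict_of_bireflection (h14 : Katz1990_thm14_gabber_of_ne) (h14' : Katz1990_thm14_gabber_dim8)
    (h15 : Katz1990_thm15_pseudoreflection) (h141 : Katz1990_rmk141_nonsimple)
    {K : Type} [Field K] [Algebra K ℂ] {H : Type} [AddCommGroup H] [Module K H] [FiniteDimensional K H]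
    {Q : BilinForm K H} (hQs : ∀ x y, Q x y = Q y x) {A B : H →ₗ[K] H} (W : Submodule K H)
    (hAW : ∀ x ∈ W, A x ∈ W) (hBW : ∀ x ∈ W, B x ∈ W) (hQW : ∀ x ∈ W, (∀ y ∈ W, Q x y = 0) → x = 0)
    (haa : ∀ x ∈ W, A (A x) = -x) (hbb : ∀ x ∈ W, B (B x) = -x) (hab : ∀ x ∈ W, A (B x) = -B (A x))
    (haQ : ∀ x ∈ W, ∀ y ∈ W, Q (A x) (A y) = Q x y) (hQb : ∀ x ∈ W, ∀ y ∈ W, Q (B x) (B y) = Q x y) {i : ℂ} (hi : i * i = -1)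
    (hM : 6 ≤ finrank ℂ ↥(W.baseChange ℂ ⊓ Module.End.eigenspace (A.baseChange ℂ) i))
    {Γ : Subgroup (H ≃ₗ[K] H)} (hΓW : ∀ γ ∈ Γ, ∀ x ∈ W, γ x ∈ W) (hΓa : ∀ γ ∈ Γ, ∀ x ∈ W, γ (A x) = A (γ x))
    (hΓb : ∀ γ ∈ Γ, ∀ x ∈ W, γ (B x) = B (γ x)) (hΓQ : ∀ γ ∈ Γ, ∀ x ∈ W, ∀ y ∈ W, Q (γ x) (γ y) = Q x y)
    (h_sirr : ∀ Γ' : Subgroup (H ≃ₗ[K] H), Γ' ≤ Γ → (Γ'.subgroupOf Γ).FiniteIndex →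
      ∀ F : Submodule ℂ (ℂ ⊗[K] H), F ≤ W.baseChange ℂ ⊓ Module.End.eigenspace (A.baseChange ℂ) i →
      (∀ γ ∈ Γ', ∀ x ∈ F, (γ.toLinearMap.baseChange ℂ) x ∈ F) → F = ⊥ ∨ F = W.baseChange ℂ ⊓ Module.End.eigenspace (A.baseChange ℂ) i)
    (h_bi : ∃ γ ∈ Γ, ∃ ℓp ℓm : ℂ ⊗[K] H, ℓp ∈ W.baseChange ℂ ∧ ℓm ∈ W.baseChange ℂ ∧ A.baseChange ℂ ℓp = i • ℓp ∧
      A.baseChange ℂ ℓm = i • ℓm ∧ (Q.baseChange ℂ) ℓp (B.baseChange ℂ ℓm) ≠ 0 ∧ (γ.toLinearMap.baseChange ℂ) ℓp = i • ℓp ∧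
      (γ.toLinearMap.baseChange ℂ) ℓm = (-i) • ℓm ∧ ∀ x ∈ W.baseChange ℂ, A.baseChange ℂ x = i • x →
        (Q.baseChange ℂ) x (B.baseChange ℂ ℓp) = 0 → (Q.baseChange ℂ) x (B.baseChange ℂ ℓm) = 0 → (γ.toLinearMap.baseChange ℂ) x = x)
    {ΓW : Subgroup (W ≃ₗ[K] W)} (hΓW' : ∀ η : W ≃ₗ[K] W, η ∈ ΓW ↔ ∃ θ ∈ Γ, ∀ x : W, ((η x : W) : H) = θ x)
    {g : H ≃ₗ[K] H} (hga : ∀ x ∈ W, g (A x) = A (g x)) (hgb : ∀ x ∈ W, g (B x) = B (g x))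
    (hgQ : ∀ x ∈ W, ∀ y ∈ W, Q (g x) (g y) = Q x y) {gW : W ≃ₗ[K] W} (hgW : ∀ x : W, ((gW x : W) : H) = g x) :
    gW ∈ glIdentityComponent ΓW := by
  classical
  -- the restricted data on `V := W`
  set φ := W.subtype.baseChange ℂ with hφdef
  have hφ : Function.Injective φ := subtype_baseChange_injective W
  set a : W →ₗ[K] W := A.restrict hAW with ha
  set b : W →ₗ[K] W := B.restrict hBW with hb
  set QW : BilinForm K W := Q.compl₁₂ W.subtype W.subtype with hQW'
  have hQWapp : ∀ x y : W, QW x y = Q (x : H) (y : H) := fun x y => rfl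
  have hnatA : ∀ y, φ (a.baseChange ℂ y) = A.baseChange ℂ (φ y) := subtype_baseChange_comm W (η := a) (f := A) fun x => rfl
  have hnatB : ∀ y, φ (b.baseChange ℂ y) = B.baseChange ℂ (φ y) := subtype_baseChange_comm W (η := b) (f := B) fun x => rfl
  have hform : ∀ y y', QW.baseChange ℂ y y' = Q.baseChange ℂ (φ y) (φ y') := baseChange_compl₁₂_subtype W Q
  have heig : ∀ y, a.baseChange ℂ y = i • y ↔ A.baseChange ℂ (φ y) = i • φ y := restrict_baseChange_eq_smul_iff W hAW i
  have hMap : (Module.End.eigenspace (a.baseChange ℂ) i).map φ = W.baseChange ℂ ⊓ Module.End.eigenspace (A.baseChange ℂ) i :=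
    map_eigenspace_restrict_eq W hAW i
  -- §A the quaternionic data on `W`
  have hQs' : ∀ x y : W, QW x y = QW y x := fun x y => hQs x y
  have hQn' : QW.Nondegenerate := by
    refine ⟨fun x hx => Subtype.ext (hQW x x.2 fun y hy => hx ⟨y, hy⟩), fun y hy => Subtype.ext (hQW y y.2 fun x hx => ?_)⟩
    rw [hQs]; exact hy ⟨x, hx⟩
  have haa' : ∀ x : W, a (a x) = -x := fun x => Subtype.ext (haa x x.2)
  have hbb' : ∀ x : W, b (b x) = -x := fun x => Subtype.ext (hbb x x.2)
  have hab' : ∀ x : W, a (b x) = -b (a x) := fun x => Subtype.ext (hab x x.2)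
  have haQ' : ∀ x y : W, QW (a x) (a y) = QW x y := fun x y => haQ x x.2 y y.2
  have hQb' : ∀ x y : W, QW (b x) (b y) = QW x y := fun x y => hQb x x.2 y y.2
  have hM' : 6 ≤ finrank ℂ (Module.End.eigenspace (a.baseChange ℂ) i) := by
    rw [LinearEquiv.finrank_eq (Submodule.equivMapOfInjective φ hφ (Module.End.eigenspace (a.baseChange ℂ) i)), hMap]
    exact hM
  -- §B the restricted group `Γ_W`
  have hΓa' : ∀ η ∈ ΓW, ∀ x, η (a x) = a (η x) := fun η hη x => by
    obtain ⟨θ, hθ, hηθ⟩ := (hΓW' η).1 hη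
    exact Subtype.ext (by rw [hηθ]; change θ (A x) = A (η x : H); rw [hΓa θ hθ x x.2, ← hηθ])
  have hΓb' : ∀ η ∈ ΓW, ∀ x, η (b x) = b (η x) := fun η hη x => by
    obtain ⟨θ, hθ, hηθ⟩ := (hΓW' η).1 hη
    exact Subtype.ext (by rw [hηθ]; change θ (B x) = B (η x : H); rw [hΓb θ hθ x x.2, ← hηθ])
  have hΓQ' : ∀ η ∈ ΓW, ∀ x y, QW (η x) (η y) = QW x y := fun η hη x y => by
    obtain ⟨θ, hθ, hηθ⟩ := (hΓW' η).1 hη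
    rw [hQWapp, hQWapp, hηθ, hηθ]; exact hΓQ θ hθ x x.2 y y.2
  -- §C (h_sirr) on `V := W`, rational side
  have h_sirr' : ∀ Γ' : Subgroup (W ≃ₗ[K] W), Γ' ≤ ΓW → (Γ'.subgroupOf ΓW).FiniteIndex →
      ∀ F : Submodule ℂ (ℂ ⊗[K] W), F ≤ Module.End.eigenspace (a.baseChange ℂ) i →
      (∀ γ ∈ Γ', ∀ x ∈ F, (γ : W →ₗ[K] W).baseChange ℂ x ∈ F) → F = ⊥ ∨ F = Module.End.eigenspace (a.baseChange ℂ) i := by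
    intro Γq hΓq hfi F hFM hFst
    obtain ⟨Θ', hΘ'le, hΘ'fi, hΘ'res⟩ := exists_finiteIndex_restrict_of_finiteIndex W hΓW hΓW' (Δ := Γq) hfi
    have hFM' : F.map φ ≤ W.baseChange ℂ ⊓ Module.End.eigenspace (A.baseChange ℂ) i := by
      rw [← hMap]; exact Submodule.map_mono hFM
    have hFst' : ∀ γ ∈ Θ', ∀ x ∈ F.map φ, (γ.toLinearMap.baseChange ℂ) x ∈ F.map φ := by
      rintro γ hγ _ ⟨y, hy, rfl⟩
      obtain ⟨η, hη, hηγ⟩ := hΘ'res γ hγ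
      refine ⟨(η : W →ₗ[K] W).baseChange ℂ y, hFst η hη y hy, ?_⟩
      exact subtype_baseChange_comm W hηγ y
    rcases h_sirr Θ' hΘ'le hΘ'fi (F.map φ) hFM' hFst' with h0 | h1
    · left
      exact Submodule.map_injective_of_injective hφ (by rw [h0, Submodule.map_bot])
    · right
      exact Submodule.map_injective_of_injective hφ (by rw [h1, hMap])
  -- §D (h_bi) on `V := W`
  have h_bi' : ∃ η ∈ ΓW, ∃ ℓp ℓm : ℂ ⊗[K] W, a.baseChange ℂ ℓp = i • ℓp ∧ a.baseChange ℂ ℓm = i • ℓm ∧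
      QW.baseChange ℂ ℓp (b.baseChange ℂ ℓm) ≠ 0 ∧ (η : W →ₗ[K] W).baseChange ℂ ℓp = i • ℓp ∧
      (η : W →ₗ[K] W).baseChange ℂ ℓm = (-i) • ℓm ∧
      ∀ x, a.baseChange ℂ x = i • x → QW.baseChange ℂ x (b.baseChange ℂ ℓp) = 0 → QW.baseChange ℂ x (b.baseChange ℂ ℓm) = 0 →
        (η : W →ₗ[K] W).baseChange ℂ x = x := by
    obtain ⟨γ, hγ, ℓp, ℓm, hℓp, hℓm, h1, h2, h3, h4, h5, h6⟩ := h_bi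
    obtain ⟨yp, rfl⟩ := (mem_baseChange_iff_exists W).1 hℓp
    obtain ⟨ym, rfl⟩ := (mem_baseChange_iff_exists W).1 hℓm
    -- the restriction `η` of `γ` to `W`
    have hγW : ∀ x ∈ W, γ x ∈ W := hΓW γ hγ
    have hγW' : ∀ x ∈ W, γ.symm x ∈ W := fun x hx => hΓW γ⁻¹ (Γ.inv_mem hγ) x hx
    let η : W ≃ₗ[K] W := LinearEquiv.ofLinear ((γ : H →ₗ[K] H).restrict hγW) ((γ.symm : H →ₗ[K] H).restrict hγW')
      (LinearMap.ext fun x => Subtype.ext (by simp)) (LinearMap.ext fun x => Subtype.ext (by simp))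
    have hη : ∀ x : W, ((η x : W) : H) = γ x := fun x => rfl
    have hnatη : ∀ y, φ ((η : W →ₗ[K] W).baseChange ℂ y) = (γ.toLinearMap.baseChange ℂ) (φ y) :=
      subtype_baseChange_comm W hη
    refine ⟨η, (hΓW' η).2 ⟨γ, hγ, hη⟩, yp, ym, (heig yp).2 h1, (heig ym).2 h2, ?_, ?_, ?_, ?_⟩
    · rw [hform, hnatB]; exact h3
    · exact hφ (by rw [hnatη, h4, map_smul])
    · exact hφ (by rw [hnatη, h5, map_smul])
    · intro x hx hp hm
      apply hφ
      rw [hnatη]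
      refine h6 (φ x) ((mem_baseChange_iff_exists W).2 ⟨x, rfl⟩) ((heig x).1 hx) ?_ ?_
      · rw [← hnatB, ← hform]; exact hp
      · rw [← hnatB, ← hform]; exact hm
  -- §E the element `g_W`
  have hga' : ∀ x, gW (a x) = a (gW x) := fun x =>
    Subtype.ext (by rw [hgW]; change g (A x) = A (gW x : H); rw [hga x x.2, ← hgW])
  have hgb' : ∀ x, gW (b x) = b (gW x) := fun x =>
    Subtype.ext (by rw [hgW]; change g (B x) = B (gW x : H); rw [hgb x x.2, ← hgW])
  have hgQ' : ∀ x y, QW (gW x) (gW y) = QW x y := fun x y => by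
    rw [hQWapp, hQWapp, hgW, hgW]; exact hgQ x x.2 y y.2
  exact mem_glIdentityComponent_of_bireflection_baseChange' h14 h14' h15 h141 hQs' hQn' haa' hbb' hab' haQ' hQb' hi hM' hΓa' hΓb'
    hΓQ' h_sirr' h_bi' hga' hgb' hgQ'

end Summit.HodgeConjecture.HodgeConjecture.Theorems.Q8BireflectionGroupDensityAmbient

end
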